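import Literature.AlgebraicGeometry.Frobenioids.Thm36SubRlfCompletion
import Literature.AlgebraicGeometry.Frobenioids.Thm36SubProofs3
import Literature.AlgebraicGeometry.Frobenioids.Thm36SubSlim
import Literature.AlgebraicGeometry.Frobenioids.Thm36SubAmpleTypesQ
import Literature.AlgebraicGeometry.Frobenioids.Thm36SubIndissectR
import Literature.AlgebraicGeometry.Frobenioids.Thm36SubIxQ
import Literature.AlgebraicGeometry.Frobenioids.ArchimedeanSlimInstances
import Literature.AlgebraicGeometry.Frobenioids.ArchimedeanDissectionProofs
import HarnessLib

/-!
# Frobenioids II, Theorem 3.6 for `C^Λ`, ALL `Λ ∈ {ℤ, ℚ, ℝ}`: the instance statements DISCHARGED — part B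
# ((i) typology, (ix), (x))

Mochizuki, *The geometry of Frobenioids II*, Kyushu J. Math. **62** (2008) 401–460, Theorem 3.6 pp. 36–38,
for the archimedean Frobenioids `C^ℤ := C`, `C^ℚ := C^pf`, `C^ℝ := C^rlf` of Example 3.3 (ii) p. 28.  The
typer's `Λ`-indexed instance statements (`ArchimedeanTheoremsInstances.lean`, seat abc-iut-L1-t9) are
parametrised by completion data `pf rlf : LambdaCompletion π`; at THE data
`(pf, rlf) := (Thm36Sub.pfCompletion π hF, Thm36Sub.rlfCompletion π)` (THE perfection of [FrdI] Def. 3.1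
(iii) and THE realification of [FrdI] Prop. 5.3) their three conjuncts are, definitionally, the landed
`Λ = ℤ` theorems (seats t6 / t9 / d103 / d027 / L6-d7 …) and the `…_Q` / `…_R` slots of `Thm36Sub.lean`
(abc-iut cell, L1 row M13), all of which are now closed in the tree (seats w4-d074, w5-d161, w5-d190, w5-d237,
L1-d5, w5-d036).  This PROOF-ONLY file (part B; part A = `Thm36SubInstancesA.lean`: (i) «istr» clauses, (iv), (v), (vi),
(viii)) assembles BY NAME: Thm. 3.6 (i) typology [«`Aut`-ample, `Aut^sub`-ample, `End`-ample, metrically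
trivial, not group-like»], (ix) (also the reduction `thm36ix_CA_of_ix_Q` to the `Λ = ℚ` slot, closed by
`ix_Q_holds` of seat w5-d036) and (x).  The
standing hypothesis `hF : IsFrobenioid (C → F_Φ)` ("`C` is a Frobenioid", Ex. 3.3 (ii); it carries
"`D` connected") is the parameter of THE perfection.  No side taken on [IUTchIII] Cor. 3.12.
-/

noncomputable section

namespace Literature.AlgebraicGeometry.Frobenioids

open CategoryTheory Opposite

universe v u

namespace ArchFrd

namespace Thm36Sub

variable {D : Type u} [Category.{v} D] (π : D ⥤ D0)

/-- **Thm. 3.6 (i)** "`C^Λ` is of `Aut`-ample, `Aut^sub`-ample, `End`-ample and metrically trivial type, but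
not of group-like type" — t9's instance `Thm36i_ampleTypes_C` DISCHARGED at THE data (`thm36i_ampleTypes_C`,
seat t6; `ampleTypes_Q_holds`, seat w5-d161; `ampleTypes_R_holds`; the connectedness of `D` used at `Λ ∈ {ℤ, ℝ}`
is carried by `hF`). [cite: MochizukiFrdII2008, Thm 3.6 (i) p.36] -/
theorem thm36i_ampleTypes_C_holds (hF : PreFrobenioid.IsFrobenioid (C.toElem π)) :
    Literature.AlgebraicGeometry.Frobenioids.ArchFrd.Thm36i_ampleTypes_C π (pfCompletion π hF)
      (rlfCompletion π) := by
  intro Λ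
  cases Λ with
  | Z => exact thm36i_ampleTypes_C π hF.isPreFrobenioid.isGraphConnected_base
  | Q => exact ampleTypes_Q_holds π hF
  | R => exact ampleTypes_R_holds π hF.isPreFrobenioid.isGraphConnected_base

/-- **Thm. 3.6 (ix)** (strong indissectibility of `F^istr`) — t9's instance `Thm36ix_CA` at THE data REDUCED to
its `Λ = ℚ` slot `Thm36Sub.ix_Q` (d027's `thm36ix_CA_of`; `ix_R_holds`, seat L1-d5).
[cite: MochizukiFrdII2008, Thm 3.6 (ix) p.38] -/
theorem thm36ix_CA_of_ix_Q (hF : PreFrobenioid.IsFrobenioid (C.toElem π)) (hQ : ix_Q π hF) :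
    Literature.AlgebraicGeometry.Frobenioids.ArchFrd.Thm36ix_CA π (pfCompletion π hF) (rlfCompletion π) :=
  thm36ix_CA_of π _ _ hQ (ix_R_holds π)

/-- **Thm. 3.6 (ix)** ("suppose that `D` is of strongly indissectible type [if `D` is not complexifiable, assume
further that `Λ ≠ ℤ`]; then `F^istr` is of strongly indissectible type", `F ∈ {C^Λ, A}`) — t9's instance
`Thm36ix_CA` DISCHARGED at THE data (`ix_Q_holds`, seat w5-d036; `ix_R_holds`, seat L1-d5; `Λ = ℤ` and `A` via
d027's `thm36ix_CA_of`). [cite: MochizukiFrdII2008, Thm 3.6 (ix) p.38] -/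
theorem thm36ix_CA_holds (hF : PreFrobenioid.IsFrobenioid (C.toElem π)) :
    Literature.AlgebraicGeometry.Frobenioids.ArchFrd.Thm36ix_CA π (pfCompletion π hF) (rlfCompletion π) :=
  thm36ix_CA_of_ix_Q π hF (ix_Q_holds π hF)

/-- **Thm. 3.6 (x)** ("if `D` is slim, and `Λ ∈ {ℤ, ℝ}`, then `F` is slim") — t9's instance `Thm36x_CA`
DISCHARGED for EVERY perfection datum `pf` and THE realification (d091/d103's `thm36x_CA_of_rlf`: the
`Λ = ℚ` conjunct is vacuous; `x_R_holds`). [cite: MochizukiFrdII2008, Thm 3.6 (x) p.38] -/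
theorem thm36x_CA_holds (pf : LambdaCompletion π) :
    Literature.AlgebraicGeometry.Frobenioids.ArchFrd.Thm36x_CA π pf (rlfCompletion π) :=
  thm36x_CA_of_rlf π pf _ (x_R_holds π)

end Thm36Sub

end ArchFrd

end Literature.AlgebraicGeometry.Frobenioids
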